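import Summits.HodgeConjecture.HodgeConjecture.Theses.NikulinTwinTransport
import Summits.HodgeConjecture.HodgeConjecture.Theorems.NikulinTwinTransportTwinSimilitudeAlgebraicMarkings
import Literature.AlgebraicGeometry.Surfaces.K3Marking
import Literature.AlgebraicGeometry.Surfaces.K3MarkingProofs
import Literature.AlgebraicGeometry.Surfaces.K3SurfaceProofs
import HarnessLib

/-!
# Route NikulinTwinTransport · crux `TwinSimilitudeAlgebraic` (stmt-HodgeConjecture-13674) —
# stub `stub_markingPeriodPt` of line `hyperkaehler-nikulin-anchors` (reshape r2)

**The projective period clauses hold for EVERY marking of a projective K3 surface** (K3 linear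
algebra). The named fact `Huybrechts_K3_marking_exists` (Huybrechts, *Lectures on K3 Surfaces*,
Ch. 1 Prop. 3.5 with Ch. 6 Prop. 1.2 and Ch. 1 §3) hands, for a K3 surface `S`, ONE marking
`(η₀, p₀, x₀)` — `η₀ : H²(S(ℂ); ℂ) ≅ Λ_ℂ` identifying the integral classes with `ℤ²²`,
`a ∪ b = (η₀a.η₀b) p₀` with `p₀ ≠ 0` an integral generator of `H⁴`, `η₀⁻¹x₀` spanning the
`(2,0)`-classes — together with the period clauses `(x₀.x₀) = 0`, `re (x̄₀.x₀) > 0` and a positive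
lattice vector `u₀ ⊥ x₀` (an ample class). The registered stub `stub_markingPeriodPt` asks for the
same three period clauses for an ARBITRARY marking `(η, p, x)` of `S` satisfying the six marking
clauses.

Proof (Huybrechts Ch. 6 §3.2, "`O(Λ)` acts on marked K3 surfaces by `(X, φ) ↦ (X, γ ∘ φ)`", read
backwards: any two markings differ by `O(Λ)`). The change of marking `σ := η ∘ η₀⁻¹ : Λ_ℂ → Λ_ℂ`
maps `ℤ²²` into `ℤ²²` (both markings identify the integral classes with `ℤ²²`), hence is real
(`ratEnd_star`). The two integral generators satisfy `p = ±p₀` (`eq_or_eq_neg_of_zsmul`); reading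
the two cup-product clauses through `η₀⁻¹` gives `(σa.σb) p = (a.b) p₀`, so `p = -p₀` would make
`σ` an anti-isometry of `Λ_ℚ`, impossible by the signature `(3,19)` (`not_antiIsometry_k3Form`);
hence `p = p₀` and `σ` is an isometry of `(Λ_ℂ, k3Form)` (`k3Form_markingChange`). On the
`(2,0)`-line, `η⁻¹x = s η₀⁻¹x₀` and `η₀⁻¹x₀ = t η⁻¹x` with `η₀⁻¹x₀ ≠ 0`, so `s ≠ 0` and
`x = s · σx₀`. Finally the period clauses are invariant under the real isometry `σ` preserving
`ℤ²²` (`(σx₀.σx₀) = 0`, `(σx̄₀.σx₀) = (x̄₀.x₀)`, `σu₀ ∈ ℤ²²` positive and orthogonal to `σx₀`) and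
under `x ↦ s x` (`Huybrechts_K3_periodSurjective_projective.hypotheses_smul`).

Hypotheses (all in the registered signature): `Huybrechts_K3_marking_exists`. No other named fact
is used. Prover seat prover-line-stmt-HodgeConjecture-13674-c1-0.

## References

* [Huybrechts2016K3] D. Huybrechts, Lectures on K3 Surfaces, CUP 2016, Ch. 1 Prop. 3.5 and §3.3
  (markings, `Λ = E₈(−1)^{⊕2} ⊕ U^{⊕3}`), Ch. 6 §1.1 and Prop. 1.2 (the period domain), Ch. 6 §3.2
  (the action of `O(Λ)` on marked K3 surfaces), Ch. 14 §0.3 (vi) (signature `(3,19)`).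
* [Buskin2019] N. Buskin, Every rational Hodge isometry between two K3 surfaces is algebraic,
  J. reine angew. Math. 755 (2019), §6.2 (isometries induced via markings).
-/

noncomputable section

set_option linter.dupNamespace false

open CategoryTheory MonoidalCategory
open Literature.AlgebraicGeometry.Motives Literature.AlgebraicGeometry.HodgeTheory
open Literature.AlgebraicGeometry.Surfaces
open Literature.AlgebraicTopology.SingularHomology
open Summit.HodgeConjecture.HodgeConjecture.Theses.NikulinTwinTransport

namespace Summit.HodgeConjecture.HodgeConjecture.Theorems.NikulinTwinTransport

/-! ## Local notation — VERBATIM that of the registered skeleton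
`Cruxes/TwinSimilitudeAlgebraic/Lines/hyperkaehler_nikulin_anchors.lean` -/

/-- `MarkedK3[S, η, p, x]`: a marked K3 surface with period `x` — the six marking clauses of the named
facts `Huybrechts_K3_marking_exists` / `Huybrechts_K3_periodSurjective_projective`. Local notation only,
verbatim from `NikulinTwinTransportHodgeSimilitudeAlgebraicAnchors`. -/
local notation3 (prettyPrint := false) "MarkedK3[" S ", " η ", " p ", " x "]" =>
  (IsIntegralClass p ∧
    (∀ q : complexBetti S (2 * 2), IsIntegralClass q → ∃ n : ℤ, q = n • p) ∧
    (∀ c : complexBetti S (2 * 1), IsIntegralClass c ↔ ∃ v : K3Index → ℤ, η c = fun i => (v i : ℂ)) ∧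
    (∀ a b : complexBetti S (2 * 1),
        cupProduct (rfl : 2 * 1 + 2 * 1 = 2 * 2) a b = k3Form (η a) (η b) • p) ∧
    IsOfHodgeType 2 S (2 * 1) 2 0 (LinearEquiv.symm η x) ∧
    (∀ τ : complexBetti S (2 * 1), IsOfHodgeType 2 S (2 * 1) 2 0 τ → ∃ t : ℂ, τ = t • LinearEquiv.symm η x))

/-! ## Two markings of one K3 surface differ by an integral isometry of `Λ_{K3}` -/

section TwoMarkings

variable {S : SchemeOver ℂ}
  {η η₀ : complexBetti S (2 * 1) ≃ₗ[ℂ] (K3Index → ℂ)} {p p₀ : complexBetti S (2 * 2)}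
  {σ : Module.End ℂ (K3Index → ℂ)}

/-- **The change of marking preserves the lattice.** If two markings `η, η₀ : H²(S(ℂ); ℂ) ≅ Λ_ℂ`
both identify the integral classes with `ℤ²²`, then `σ = η ∘ η₀⁻¹` maps `ℤ²²` into `ℤ²²`.
[cite: Huybrechts2016K3, Ch. 1 §3.3 and Ch. 6 §3.2] -/
theorem markingChange_intCast
    (hint : ∀ c : complexBetti S (2 * 1), IsIntegralClass c ↔ ∃ v : K3Index → ℤ, η c = fun i => (v i : ℂ))
    (hint₀ : ∀ c : complexBetti S (2 * 1), IsIntegralClass c ↔ ∃ v : K3Index → ℤ, η₀ c = fun i => (v i : ℂ))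
    (hσ : ∀ z, σ z = η (η₀.symm z)) (v : K3Index → ℤ) :
    ∃ w : K3Index → ℤ, σ (fun i => (v i : ℂ)) = fun i => (w i : ℂ) := by
  rw [hσ]
  exact (hint _).1 ((hint₀ _).2 ⟨v, η₀.apply_symm_apply _⟩)

/-- The change of marking `σ = η ∘ η₀⁻¹` is defined over `ℚ` (it even preserves `ℤ²²`), the shape of
the rationality hypothesis of `ratEnd_star` / `not_antiIsometry_k3Form`.
[cite: Huybrechts2016K3, Ch. 1 §3.3] -/
theorem markingChange_ratCast
    (hint : ∀ c : complexBetti S (2 * 1), IsIntegralClass c ↔ ∃ v : K3Index → ℤ, η c = fun i => (v i : ℂ))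
    (hint₀ : ∀ c : complexBetti S (2 * 1), IsIntegralClass c ↔ ∃ v : K3Index → ℤ, η₀ c = fun i => (v i : ℂ))
    (hσ : ∀ z, σ z = η (η₀.symm z)) (v : K3Index → ℤ) :
    ∃ w : K3Index → ℚ, σ (fun i => (v i : ℂ)) = fun i => (w i : ℂ) := by
  obtain ⟨w, hw⟩ := markingChange_intCast hint hint₀ hσ v
  refine ⟨fun i => (w i : ℚ), ?_⟩
  rw [hw]
  funext i
  exact (Rat.cast_intCast (w i)).symm

/-- **Two markings of a K3 surface differ by an isometry of `Λ_ℂ`** (Huybrechts Ch. 6 §3.2: the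
markings of `X` form one `O(Λ)`-orbit `(X, φ) ↦ (X, γ ∘ φ)`). With `(η, p)` and `(η₀, p₀)` two
markings in the sense of `Huybrechts_K3_marking_exists` (integral classes `↔ ℤ²²`,
`a ∪ b = (η a.η b) p = (η₀ a.η₀ b) p₀`, `p`, `p₀ ≠ 0` integral generators of `H⁴`): `p = ±p₀`
(`eq_or_eq_neg_of_zsmul`), and `p = -p₀` would make `σ = η ∘ η₀⁻¹` a rational anti-isometry of
`Λ_ℚ`, which the signature `(3,19)` forbids (`not_antiIsometry_k3Form`); so `p = p₀` and
`(σa.σb) = (a.b)`. [cite: Huybrechts2016K3, Ch. 6 §3.2 and Ch. 14 §0.3 (vi)]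
[cite: Buskin2019, §6.2, proof of Thm. 1.1] -/
theorem k3Form_markingChange (hp₀ : p₀ ≠ 0) (hpint : IsIntegralClass p)
    (hgen : ∀ q : complexBetti S (2 * 2), IsIntegralClass q → ∃ n : ℤ, q = n • p)
    (hint : ∀ c : complexBetti S (2 * 1), IsIntegralClass c ↔ ∃ v : K3Index → ℤ, η c = fun i => (v i : ℂ))
    (hcup : ∀ a b : complexBetti S (2 * 1),
      cupProduct (rfl : 2 * 1 + 2 * 1 = 2 * 2) a b = k3Form (η a) (η b) • p)
    (hp₀int : IsIntegralClass p₀)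
    (hgen₀ : ∀ q : complexBetti S (2 * 2), IsIntegralClass q → ∃ n : ℤ, q = n • p₀)
    (hint₀ : ∀ c : complexBetti S (2 * 1), IsIntegralClass c ↔ ∃ v : K3Index → ℤ, η₀ c = fun i => (v i : ℂ))
    (hcup₀ : ∀ a b : complexBetti S (2 * 1),
      cupProduct (rfl : 2 * 1 + 2 * 1 = 2 * 2) a b = k3Form (η₀ a) (η₀ b) • p₀)
    (hσ : ∀ z, σ z = η (η₀.symm z)) (a b : K3Index → ℂ) :
    k3Form (σ a) (σ b) = k3Form a b := by
  -- the two cup-product clauses read through `η₀⁻¹`: `(a.b) p₀ = (σa.σb) p`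
  have key : ∀ a b : K3Index → ℂ, k3Form a b • p₀ = k3Form (σ a) (σ b) • p := fun a b => by
    have h := hcup (η₀.symm a) (η₀.symm b)
    rwa [hcup₀, LinearEquiv.apply_symm_apply, LinearEquiv.apply_symm_apply, ← hσ, ← hσ] at h
  -- `p = p₀` or `p = -p₀`
  rcases eq_or_eq_neg_of_zsmul hp₀ (hgen p₀ hp₀int) (hgen₀ p hpint) with h | h
  · have h1 := key a b
    rw [h] at h1
    exact (smul_left_injective ℂ hp₀ h1).symm
  · -- `p = -p₀`: `σ` would be a rational anti-isometry of `Λ_{K3}`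
    exfalso
    refine not_antiIsometry_k3Form σ (fun a b => ?_) (markingChange_ratCast hint hint₀ hσ)
    have h1 := key a b
    rw [h, smul_neg, ← neg_smul] at h1
    have h2 : k3Form a b = -k3Form (σ a) (σ b) := smul_left_injective ℂ hp₀ h1
    rw [h2, neg_neg]

end TwoMarkings

/-! ## The stub -/

/-- **Sub-stub C — `MarkingPeriodPt` (registered stub `stub_markingPeriodPt` of line
`hyperkaehler-nikulin-anchors`): the projective period clauses hold for EVERY marking of a
projective K3 surface**, not only for the one provided by `Huybrechts_K3_marking_exists`. With
`(η₀, p₀, x₀)` the marking of the fact and `(η, p, x)` any marking: `σ = η ∘ η₀⁻¹` is a real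
isometry of `Λ_ℂ` preserving `ℤ²²` (`k3Form_markingChange`, `ratEnd_star`); `η⁻¹x = s · η₀⁻¹x₀`
with `s ≠ 0` (`h^{2,0} = 1`: each of the two `(2,0)`-classes is a multiple of the other and
`η₀⁻¹x₀ ≠ 0`), i.e. `x = s · σx₀`; whence `(x.x) = s²(x₀.x₀) = 0`, `(x̄.x) = |s|²(x̄₀.x₀) > 0`, and
`σu₀` is a positive lattice vector orthogonal to `x`.
[cite: Huybrechts2016K3, Ch. 6 §3.2 and Prop. 1.2; Ch. 1 Prop. 3.5] -/
theorem stub_markingPeriodPt :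
    Huybrechts_K3_marking_exists →
    ∀ (S : SchemeOver ℂ), IsK3Surface S →
      ∀ (η : complexBetti S (2 * 1) ≃ₗ[ℂ] (K3Index → ℂ)) (p : complexBetti S (2 * 2)) (x : K3Index → ℂ),
        MarkedK3[S, η, p, x] →
        k3Form x x = 0 ∧ 0 < (k3Form (star x) x).re ∧
          ∃ u : K3Index → ℤ, k3Form (fun i => (u i : ℂ)) x = 0 ∧ 0 < ∑ i, ∑ j, u i * k3Gram i j * u j := by
  intro hmark S hS η p x hmk
  obtain ⟨hpint, hgen, hint, hcup, h20, hspan⟩ := hmk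
  obtain ⟨η₀, p₀, x₀, hp₀, ⟨hp₀int, hgen₀, hint₀, hcup₀, h20₀, hspan₀⟩, ⟨hxx₀, hpos₀, u₀, hu₀, hu₀pos⟩⟩ :=
    hmark S hS
  -- the change of marking `σ = η ∘ η₀⁻¹`: integral, real, isometric
  obtain ⟨σ, hσ⟩ : ∃ σ : Module.End ℂ (K3Index → ℂ), ∀ z, σ z = η (η₀.symm z) :=
    ⟨η.toLinearMap ∘ₗ η₀.symm.toLinearMap, fun z => rfl⟩
  have hσrat := markingChange_ratCast hint hint₀ hσ
  have hiso : ∀ a b, k3Form (σ a) (σ b) = k3Form a b :=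
    k3Form_markingChange hp₀ hpint hgen hint hcup hp₀int hgen₀ hint₀ hcup₀ hσ
  -- the `(2,0)`-line: `η⁻¹ x = s • η₀⁻¹ x₀` with `s ≠ 0`, i.e. `x = s • σ x₀`
  have hσ₀0 : η₀.symm x₀ ≠ 0 := fun h0 =>
    ne_zero_of_star_self_re_pos hpos₀ (by simpa using congrArg η₀ h0)
  obtain ⟨s, hs⟩ := hspan₀ _ h20
  obtain ⟨t, ht⟩ := hspan _ h20₀
  have hs0 : s ≠ 0 := by
    rintro rfl
    rw [zero_smul] at hs
    rw [hs, smul_zero] at ht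
    exact hσ₀0 ht
  have hx : x = s • σ x₀ := by
    have h := congrArg η hs
    rw [LinearEquiv.apply_symm_apply, map_smul, ← hσ] at h
    exact h
  -- the period clauses for `σ x₀`, then for `x = s • σ x₀`
  have h1 : k3Form (σ x₀) (σ x₀) = 0 := by rw [hiso, hxx₀]
  have h2 : 0 < (k3Form (star (σ x₀)) (σ x₀)).re := by
    rw [← ratEnd_star σ hσrat, hiso]
    exact hpos₀
  have h3 : ∃ u : K3Index → ℤ, k3Form (fun i => (u i : ℂ)) (σ x₀) = 0 ∧
      0 < ∑ i, ∑ j, u i * k3Gram i j * u j := by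
    obtain ⟨u, hu⟩ := markingChange_intCast hint hint₀ hσ u₀
    refine ⟨u, ?_, ?_⟩
    · rw [← hu, hiso, hu₀]
    · have h := hiso (fun i => (u₀ i : ℂ)) (fun i => (u₀ i : ℂ))
      rw [hu, k3Form_intCast, k3Form_intCast] at h
      rw [Int.cast_injective h]
      exact hu₀pos
  rw [hx]
  exact Huybrechts_K3_periodSurjective_projective.hypotheses_smul hs0 h1 h2 h3

end Summit.HodgeConjecture.HodgeConjecture.Theorems.NikulinTwinTransport

end
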